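import Literature.MathematicalPhysics.QuantumFieldTheory.StochasticDeterminantVariance
import HarnessLib

/-!
# Variance and existence condition of the Gaussian stochastic determinant estimator
# (Finkenrath–Knechtli–Leder), II: spectral form of the condition, the pseudofermion ratio
# `A = M†M`, and the `N`-th-root determinant factorisation (§2.3)

Topic `MathematicalPhysics/QuantumFieldTheory`, sequel to `StochasticDeterminantVariance.lean`
(the integral (2.1), the second moment (2.3) and its existence condition (2.4) in matrix form).
PUBLISHED RESULTS with our proofs — no named fact is introduced (D-0026).  Wanted by the cell
pub-lqcd (venture `LatticeQCDFlow`, HOME/R2-SCOPE.md §3 E2 D1 (the `N_η = 1` determinant-ratio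
acceptance of Knechtli–Wolff), §4 C-PM ("`C` (the single-draw noise) is the lever, i.e.
preconditioning/Hasenbusch inside the flow"); FANOUT row 38).

## The printed statements (Finkenrath–Knechtli–Leder, Nucl. Phys. B 877 (2013) 441)

* (2.4) "The first integral in Eq. (2.3) [the second moment of the single-noise Gaussian estimate
  `W_A(η) = e^{−η†(A−I)η}` of `1/det A`] exists if `λ(A + A† − I) > 0 ⟺ λ(A + A†) > 1 ⟹
  Re(λ(A)) > 0.5`"; after (2.1): `λ(A+A†) > 0` "implies the weaker condition `Re(λ(A)) > 0` … but the
  two conditions are only equivalent for normal matrices".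
* §2.3 Mass interpolation: "An estimator where the stochastic variance can be reduced (and its
  convergence controlled) … is obtained when the matrix `M`, and thus the determinant, is factorized
  `M = ∏_{l=0}^{N−1} Mₗ`.  One possible factorization is given by taking the `N`th root
  `Mₗ = M^{1/N}` [Hasenfratz:2002ym] … where for each factor `Wₗ` an independent estimator is used …
  as long as `D_{mₗ}` does not become singular, convergence can be assured by choosing `N` large
  enough, i.e., squeezing `λ(Mₗ)` in a small region around one."  PoS LATTICE2013 035 §3: "the
  condition for the variance … to exist … can always be fulfilled by choosing a large enough `N`".
* Knechtli–Wolff, Nucl. Phys. B 663 (2003) 3, §4.1 (4.5): the one-pseudofermion estimate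
  `ρ(Mη)/ρ(η) = e^{−‖Mη‖² + ‖η‖²}` of `|det M|⁻²` — the case `A = M†M`.

## What is proved here

* `posDef_sub_one_iff` / `posDef_add_conjTranspose_sub_one_iff` — (2.4)'s
  "`λ(A + A† − I) > 0 ⟺ λ(A + A†) > 1`" through the eigenvalues of the Hermitian matrix `A + A†`.
* The Knechtli–Wolff form `A = M†M`: `integrable_gaussian_mul_stochasticRatio_sq_iff` — the second
  moment `∫ρ(η)(ρ(Mη)/ρ(η))² dη` of the one-pseudofermion determinant-ratio estimate is an absolutely
  convergent integral iff `2M†M − I` is positive definite, iff every eigenvalue of `M†M` exceeds `1/2`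
  (`posDef_two_conjTranspose_mul_self_sub_one_iff`); `integral_gaussian_mul_stochasticRatio_sq` — it
  then equals `πⁿ/det(2M†M − I)`; `variance_stochasticRatio` — `σ² = 1/det(2M†M − I) − |det M|⁻⁴`
  (the mean `|det M|⁻²` being the tree's `Pseudofermion.stochasticRatio_mean`).
* §2.3 in its `N`-th-root form, for Hermitian positive-definite `A` and `A^{1/N}` by the continuous
  functional calculus: `nthRoot_pow_eq` — `(A^{1/N})^N = A` (so `1/det A` is the product of `N`
  identical factors `1/det A^{1/N}`, each to be estimated with independent noise);
  `posDef_two_nthRoot_sub_one_iff` — a factor meets the variance condition `2A^{1/N} − I > 0` iff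
  every `λᵢ(A)^{1/N} > 1/2`; `eventually_posDef_two_nthRoot_sub_one` — this holds for all
  sufficiently large `N` (`λᵢ^{1/N} → 1`).  The printed `O(1/N)` error law (2.10) is a small-step
  expansion and is not formalised; the mass-interpolation factorisation (2.8)–(2.9) concerns
  non-normal ratios `D_{m_{l+1}}⁻¹ D_{mₗ}` and is not formalised either (TODO(general form)).

## References
* [FinkenrathKnechtliLeder2013OneFlavor] J. Finkenrath, F. Knechtli, B. Leder, Nucl. Phys. B 877
  (2013) 441–456, arXiv:1306.3962, §2.1 (2.4), §2.3.
* [LederFinkenrathKnechtli2014] B. Leder, J. Finkenrath, F. Knechtli, PoS(LATTICE 2013) 035,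
  arXiv:1401.1079, §3.
* [KnechtliWolff2003] F. Knechtli, U. Wolff, Nucl. Phys. B 663 (2003) 3, §4.1 (4.5).
-/

namespace Literature.MathematicalPhysics.QuantumFieldTheory.StochasticDeterminant

open MeasureTheory Matrix Literature.Analysis.SpecialFunctions
open scoped BigOperators ComplexOrder ComplexConjugate

variable {ι : Type} [Fintype ι] [DecidableEq ι]

/-! ## Helpers (quadratic forms; the eigenvector unitary) -/

omit [DecidableEq ι] in
/-- `Re η†(A + B)η = Re η†Aη + Re η†Bη`. [folklore] -/
private theorem re_quadForm_add' (A B : Matrix ι ι ℂ) (η : ι → ℂ) :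
    (star η ⬝ᵥ ((A + B) *ᵥ η)).re = (star η ⬝ᵥ (A *ᵥ η)).re + (star η ⬝ᵥ (B *ᵥ η)).re := by
  rw [add_mulVec, dotProduct_add, Complex.add_re]

/-- `Re η†(A − I)η = Re η†Aη − Σᵢ|ηᵢ|²`. [folklore] -/
private theorem re_quadForm_sub_one' (A : Matrix ι ι ℂ) (η : ι → ℂ) :
    (star η ⬝ᵥ ((A - 1) *ᵥ η)).re = (star η ⬝ᵥ (A *ᵥ η)).re - ∑ i, ‖η i‖ ^ 2 := by
  rw [sub_mulVec, dotProduct_sub, Complex.sub_re, one_mulVec]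
  congr 1
  simp only [dotProduct, Pi.star_apply, Complex.star_def, Complex.re_sum]
  refine Finset.sum_congr rfl fun i _ => ?_
  rw [Complex.conj_mul']
  norm_cast

variable {A B : Matrix ι ι ℂ}

/-- `det U ≠ 0` for the eigenvector unitary of a Hermitian matrix (`Uᴴ U = 1`). [folklore] -/
private theorem det_eigenvectorUnitary_ne_zero' (hB : B.IsHermitian) :
    (hB.eigenvectorUnitary : Matrix ι ι ℂ).det ≠ 0 := by
  have h1 := congrArg Matrix.det (Unitary.coe_star_mul_self hB.eigenvectorUnitary)
  rw [det_mul, det_one] at h1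
  intro h
  rw [h, mul_zero] at h1
  exact zero_ne_one h1

/-! ## The spectral reading `λ(A + A†) > 1` -/

/-- `U (diag d) Uᴴ` is positive definite iff all `dᵢ > 0`, for the eigenvector unitary `U` of a
Hermitian matrix. [folklore] -/
private theorem posDef_conj_diagonal_iff (hB : B.IsHermitian) (d : ι → ℝ) :
    ((hB.eigenvectorUnitary : Matrix ι ι ℂ) * diagonal (fun i => (d i : ℂ)) *
        (hB.eigenvectorUnitary : Matrix ι ι ℂ)ᴴ).PosDef ↔ ∀ i, 0 < d i := by
  have hU : IsUnit (hB.eigenvectorUnitary : Matrix ι ι ℂ) :=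
    (isUnit_iff_isUnit_det _).mpr (Ne.isUnit (det_eigenvectorUnitary_ne_zero' hB))
  rw [← star_eq_conjTranspose, hU.posDef_star_right_conjugate_iff, posDef_diagonal_iff]
  refine forall_congr' fun i => ?_
  exact Complex.zero_lt_real

/-- `B = U diag(λ) Uᴴ` (the spectral theorem, solved for `B`). [folklore] -/
private theorem eq_conj_diagonal (hB : B.IsHermitian) :
    B = (hB.eigenvectorUnitary : Matrix ι ι ℂ) * diagonal (fun i => (hB.eigenvalues i : ℂ)) *
      (hB.eigenvectorUnitary : Matrix ι ι ℂ)ᴴ := by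
  conv_lhs => rw [hB.spectral_theorem, Unitary.conjStarAlgAut_apply, star_eq_conjTranspose]
  rfl

/-- `U Uᴴ = 1` for the eigenvector unitary. [folklore] -/
private theorem eigenvectorUnitary_mul_conjTranspose (hB : B.IsHermitian) :
    (hB.eigenvectorUnitary : Matrix ι ι ℂ) * (hB.eigenvectorUnitary : Matrix ι ι ℂ)ᴴ = 1 := by
  rw [← star_eq_conjTranspose]
  exact Unitary.coe_mul_star_self hB.eigenvectorUnitary

/-- **(2.4), first equivalence: `λ(A + A† − I) > 0 ⟺ λ(A + A†) > 1`.**  For a Hermitian `S` (here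
`S = A + A†`), `S − I` is positive definite iff every eigenvalue of `S` exceeds `1`.
[cite: FinkenrathKnechtliLeder2013OneFlavor, §2.1 eq. (2.4)] -/
theorem posDef_sub_one_iff {S : Matrix ι ι ℂ} (hS : S.IsHermitian) :
    (S - 1).PosDef ↔ ∀ i, 1 < hS.eigenvalues i := by
  have h : S - 1 = (hS.eigenvectorUnitary : Matrix ι ι ℂ) *
      diagonal (fun i => ((hS.eigenvalues i - 1 : ℝ) : ℂ)) * (hS.eigenvectorUnitary : Matrix ι ι ℂ)ᴴ := by
    have hdiag : diagonal (fun i => ((hS.eigenvalues i - 1 : ℝ) : ℂ)) =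
        diagonal (fun i => (hS.eigenvalues i : ℂ)) - 1 := by
      rw [← diagonal_one, diagonal_sub]
      congr 1
      funext i
      push_cast
      ring
    rw [hdiag, Matrix.mul_sub, Matrix.sub_mul, Matrix.mul_one, eigenvectorUnitary_mul_conjTranspose,
      ← eq_conj_diagonal hS]
  rw [h, posDef_conj_diagonal_iff]
  exact forall_congr' fun i => sub_pos

/-- The same reading with `A + A†` spelled out: `A + A† − I` is positive definite iff every
eigenvalue of the Hermitian matrix `A + A†` exceeds `1`.
[cite: FinkenrathKnechtliLeder2013OneFlavor, §2.1 eq. (2.4)] -/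
theorem posDef_add_conjTranspose_sub_one_iff (A : Matrix ι ι ℂ) :
    (A + Aᴴ - 1).PosDef ↔ ∀ i, 1 < (isHermitian_add_transpose_self A).eigenvalues i :=
  posDef_sub_one_iff _
/-! ## The Knechtli–Wolff pseudofermion form `A = M†M` -/

/-- `Re η†(M†M + M†M − I)η = 2‖Mη‖² − ‖η‖²`. [folklore] -/
private theorem re_quadForm_two_conjTranspose_mul_self_sub_one (M : Matrix ι ι ℂ) (η : ι → ℂ) :
    (star η ⬝ᵥ ((Mᴴ * M + Mᴴ * M - 1) *ᵥ η)).re =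
      2 * (∑ i, ‖(M *ᵥ η) i‖ ^ 2) - ∑ i, ‖η i‖ ^ 2 := by
  rw [re_quadForm_sub_one', re_quadForm_add', re_star_dotProduct_conjTranspose_mul_self_mulVec]
  ring

/-- The squared Knechtli–Wolff estimate times the noise density:
`ρ(η) (ρ(Mη)/ρ(η))² = e^{−(2‖Mη‖² − ‖η‖²)} = e^{−Re η†(2M†M − I)η}`. [folklore] -/
private theorem gaussian_mul_stochasticRatio_sq (M : Matrix ι ι ℂ) (η : ι → ℂ) :
    Real.exp (-(∑ i, ‖η i‖ ^ 2)) *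
        (Real.exp (-(∑ i, ‖(M *ᵥ η) i‖ ^ 2)) / Real.exp (-(∑ i, ‖η i‖ ^ 2))) ^ 2 =
      Real.exp (-(star η ⬝ᵥ ((Mᴴ * M + Mᴴ * M - 1) *ᵥ η)).re) := by
  rw [re_quadForm_two_conjTranspose_mul_self_sub_one, div_pow, ← Real.exp_nat_mul,
    ← Real.exp_nat_mul, ← Real.exp_sub, ← Real.exp_add]
  congr 1
  push_cast
  ring

/-- **Second moment of the one-pseudofermion determinant-ratio estimate exists iff `λ(M†M) > 1/2`.**
For the Knechtli–Wolff estimate `ρ(Mη)/ρ(η) = e^{−‖Mη‖² + ‖η‖²}` of `|det M|⁻²` (Gaussian `ρ`; its mean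
is the tree's `Pseudofermion.stochasticRatio_mean`), the second moment
`∫ ρ(η) (ρ(Mη)/ρ(η))² dη` is an absolutely convergent integral iff `M†M + M†M − I = 2M†M − I` is
positive definite — Finkenrath–Knechtli–Leder (2.4) at `A = M†M`.
[cite: FinkenrathKnechtliLeder2013OneFlavor, §2.1 eq. (2.4) (at A = M†M)];
[cite: KnechtliWolff2003, §4.1 eq. (4.5) (the estimator)] -/
theorem integrable_gaussian_mul_stochasticRatio_sq_iff (M : Matrix ι ι ℂ) :
    Integrable (fun η : ι → ℂ => Real.exp (-(∑ i, ‖η i‖ ^ 2)) *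
        (Real.exp (-(∑ i, ‖(M *ᵥ η) i‖ ^ 2)) / Real.exp (-(∑ i, ‖η i‖ ^ 2))) ^ 2) ↔
      (Mᴴ * M + Mᴴ * M - 1).PosDef := by
  simp_rw [gaussian_mul_stochasticRatio_sq]
  exact integrable_exp_neg_quadForm_iff
    (((isHermitian_conjTranspose_mul_self M).add (isHermitian_conjTranspose_mul_self M)).sub
      isHermitian_one)

/-- **Second moment of the one-pseudofermion determinant-ratio estimate, closed form**: if
`2M†M − I` is positive definite, `∫ ρ(η) (ρ(Mη)/ρ(η))² dη = πⁿ/det(2M†M − I)` — Finkenrath–Knechtli–Leder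
(2.3), first term, at `A = M†M`.
[cite: FinkenrathKnechtliLeder2013OneFlavor, §2.1 eq. (2.3) (at A = M†M)];
[cite: KnechtliWolff2003, §4.1 eq. (4.5) (the estimator)] -/
theorem integral_gaussian_mul_stochasticRatio_sq (M : Matrix ι ι ℂ)
    (h : (Mᴴ * M + Mᴴ * M - 1).PosDef) :
    ∫ η : ι → ℂ, Real.exp (-(∑ i, ‖η i‖ ^ 2)) *
        (Real.exp (-(∑ i, ‖(M *ᵥ η) i‖ ^ 2)) / Real.exp (-(∑ i, ‖η i‖ ^ 2))) ^ 2 =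
      Real.pi ^ Fintype.card ι / ((Mᴴ * M + Mᴴ * M - 1).det).re := by
  simp_rw [gaussian_mul_stochasticRatio_sq]
  exact complexGaussianIntegral_posDef_holds ι _ h

/-- **Variance of the one-pseudofermion determinant-ratio estimate**: for invertible `M` with
`2M†M − I` positive definite, `σ² = ⟨(ρ(Mη)/ρ(η))²⟩ − ⟨ρ(Mη)/ρ(η)⟩² = 1/det(2M†M − I) − |det M|⁻⁴`
(normalised moments, `D[η] = dη/πⁿ`; the mean `|det M|⁻²` is the tree's `stochasticRatio_mean`) —
Finkenrath–Knechtli–Leder (2.3) at `A = M†M`, where `det(AA†) = |det M|⁴`.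
[cite: FinkenrathKnechtliLeder2013OneFlavor, §2.1 eq. (2.3) (at A = M†M)];
[cite: KnechtliWolff2003, §4.1 eq. (4.5)] -/
theorem variance_stochasticRatio (M : Matrix ι ι ℂ) (hM : M.det ≠ 0)
    (h : (Mᴴ * M + Mᴴ * M - 1).PosDef) :
    (Real.pi ^ Fintype.card ι)⁻¹ * (∫ η : ι → ℂ, Real.exp (-(∑ i, ‖η i‖ ^ 2)) *
        (Real.exp (-(∑ i, ‖(M *ᵥ η) i‖ ^ 2)) / Real.exp (-(∑ i, ‖η i‖ ^ 2))) ^ 2)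
      - ((Real.pi ^ Fintype.card ι)⁻¹ * ∫ η : ι → ℂ, Real.exp (-(∑ i, ‖η i‖ ^ 2)) *
        (Real.exp (-(∑ i, ‖(M *ᵥ η) i‖ ^ 2)) / Real.exp (-(∑ i, ‖η i‖ ^ 2)))) ^ 2
      = 1 / ((Mᴴ * M + Mᴴ * M - 1).det).re - 1 / (‖M.det‖ ^ 2) ^ 2 := by
  rw [integral_gaussian_mul_stochasticRatio_sq M h, Pseudofermion.stochasticRatio_mean M hM]
  have hpi : Real.pi ^ Fintype.card ι ≠ 0 := pow_ne_zero _ Real.pi_pos.ne'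
  have hs : ((Mᴴ * M + Mᴴ * M - 1).det).re ≠ 0 := (Complex.lt_def.mp h.det_pos).1.ne'
  have hd : ‖M.det‖ ≠ 0 := norm_ne_zero_iff.mpr hM
  field_simp

/-- `U diag(d) Uᴴ + U diag(d) Uᴴ − I` is positive definite iff all `dᵢ > 1/2`, for the eigenvector
unitary `U` of a Hermitian matrix. [folklore] -/
private theorem posDef_conj_diagonal_add_self_sub_one_iff (hB : B.IsHermitian) (d : ι → ℝ) :
    ((hB.eigenvectorUnitary : Matrix ι ι ℂ) * diagonal (fun i => (d i : ℂ)) *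
          (hB.eigenvectorUnitary : Matrix ι ι ℂ)ᴴ +
        (hB.eigenvectorUnitary : Matrix ι ι ℂ) * diagonal (fun i => (d i : ℂ)) *
          (hB.eigenvectorUnitary : Matrix ι ι ℂ)ᴴ - 1).PosDef ↔ ∀ i, 1 / 2 < d i := by
  set U := (hB.eigenvectorUnitary : Matrix ι ι ℂ) with hU
  have h : U * diagonal (fun i => (d i : ℂ)) * Uᴴ + U * diagonal (fun i => (d i : ℂ)) * Uᴴ - 1 =
      U * diagonal (fun i => ((2 * d i - 1 : ℝ) : ℂ)) * Uᴴ := by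
    have hdiag : diagonal (fun i => ((2 * d i - 1 : ℝ) : ℂ)) =
        diagonal (fun i => (d i : ℂ)) + diagonal (fun i => (d i : ℂ)) - 1 := by
      rw [← diagonal_one, diagonal_add, diagonal_sub]
      congr 1
      funext i
      push_cast
      ring
    rw [hdiag, Matrix.mul_sub, Matrix.mul_add, Matrix.sub_mul, Matrix.add_mul, Matrix.mul_one, hU,
      eigenvectorUnitary_mul_conjTranspose]
  rw [h, hU, posDef_conj_diagonal_iff]
  refine forall_congr' fun i => ?_
  constructor <;> intro hi <;> linarith

/-- **The eigenvalue reading at `A = M†M`: `2M†M − I > 0 ⟺` every eigenvalue of `M†M` exceeds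
`1/2`** (Finkenrath–Knechtli–Leder's "`⟹ Re λ(A) > 0.5`", an equivalence here because `M†M` is
normal). [cite: FinkenrathKnechtliLeder2013OneFlavor, §2.1 eq. (2.4) (normal case, sentence after
eq. (2.1))] -/
theorem posDef_two_conjTranspose_mul_self_sub_one_iff (M : Matrix ι ι ℂ) :
    (Mᴴ * M + Mᴴ * M - 1).PosDef ↔
      ∀ i, 1 / 2 < (isHermitian_conjTranspose_mul_self M).eigenvalues i := by
  have h := posDef_conj_diagonal_add_self_sub_one_iff (isHermitian_conjTranspose_mul_self M)
    (isHermitian_conjTranspose_mul_self M).eigenvalues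
  rwa [← eq_conj_diagonal (isHermitian_conjTranspose_mul_self M)] at h

/-! ## §2.3: the `N`-th-root determinant factorisation restores a finite variance -/

/-- The functional calculus of a Hermitian matrix in the form `U diag(f(λᵢ)) Uᴴ`. [folklore] -/
private theorem cfc_eq_conj_diagonal (hB : B.IsHermitian) (f : ℝ → ℝ) :
    cfc f B = (hB.eigenvectorUnitary : Matrix ι ι ℂ) *
      diagonal (fun i => ((f (hB.eigenvalues i) : ℝ) : ℂ)) *
        (hB.eigenvectorUnitary : Matrix ι ι ℂ)ᴴ := by
  rw [hB.cfc_eq, Matrix.IsHermitian.cfc, Unitary.conjStarAlgAut_apply, star_eq_conjTranspose]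
  rfl

/-- `f(B) + f(B) − I` is positive definite iff `f(λᵢ) > 1/2` for every eigenvalue. [folklore] -/
private theorem posDef_two_cfc_sub_one_iff (hB : B.IsHermitian) (f : ℝ → ℝ) :
    (cfc f B + cfc f B - 1).PosDef ↔ ∀ i, 1 / 2 < f (hB.eigenvalues i) := by
  rw [cfc_eq_conj_diagonal hB f]
  exact posDef_conj_diagonal_add_self_sub_one_iff hB _

/-- **The `N`-th root is a determinant factorisation**: for Hermitian positive-definite `A` and
`N ≥ 1`, the positive `N`-th root `A^{1/N}` (functional calculus) satisfies `(A^{1/N})^N = A`, so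
`det A = (det A^{1/N})^N` and `1/det A` is the product of `N` identical factors, each to be
estimated with independent noise (Finkenrath–Knechtli–Leder §2.3: "`M = ∏ₗ Mₗ` … One possible
factorization is given by taking the `N`th root `Mₗ = M^{1/N}`").
[cite: FinkenrathKnechtliLeder2013OneFlavor, §2.3 (first paragraph)] -/
theorem nthRoot_pow_eq (hA : A.PosDef) {N : ℕ} (hN : N ≠ 0) :
    (cfc (fun x : ℝ => x ^ (1 / (N : ℝ))) A) ^ N = A := by
  have hA' : IsSelfAdjoint A := hA.1.isSelfAdjoint
  have hcont : ContinuousOn (fun x : ℝ => x ^ (1 / (N : ℝ))) (spectrum ℝ A) :=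
    (Real.continuous_rpow_const (by positivity)).continuousOn
  rw [← cfc_pow (fun x : ℝ => x ^ (1 / (N : ℝ))) N A hcont]
  conv_rhs => rw [← cfc_id' ℝ A hA']
  refine cfc_congr fun x hx => ?_
  rw [hA.1.spectrum_real_eq_range_eigenvalues] at hx
  obtain ⟨i, rfl⟩ := hx
  have hpos := hA.eigenvalues_pos i
  show (hA.1.eigenvalues i ^ (1 / (N : ℝ))) ^ N = hA.1.eigenvalues i
  rw [← Real.rpow_natCast, ← Real.rpow_mul hpos.le, one_div_mul_cancel (Nat.cast_ne_zero.mpr hN),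
    Real.rpow_one]

/-- **Each `N`-th-root factor meets the variance condition iff `λᵢ(A)^{1/N} > 1/2`**: for Hermitian
`A`, the single-noise estimate of `1/det A^{1/N}` has a finite variance
(`A^{1/N} + (A^{1/N})† − I = 2A^{1/N} − I` positive definite, cf.
`integrable_gaussian_mul_sq_norm_detInvEst_iff`) iff every eigenvalue `λᵢ` of `A` has
`λᵢ^{1/N} > 1/2`. [cite: FinkenrathKnechtliLeder2013OneFlavor, §2.1 eq. (2.4) applied to the
factors of §2.3] -/
theorem posDef_two_nthRoot_sub_one_iff (hA : A.IsHermitian) (N : ℕ) :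
    (cfc (fun x : ℝ => x ^ (1 / (N : ℝ))) A + cfc (fun x : ℝ => x ^ (1 / (N : ℝ))) A - 1).PosDef ↔
      ∀ i, 1 / 2 < hA.eigenvalues i ^ (1 / (N : ℝ)) :=
  posDef_two_cfc_sub_one_iff hA _

/-- **Factorisation restores a finite variance for `N` large enough** (Finkenrath–Knechtli–Leder
§2.3: "convergence can be assured by choosing `N` large enough, i.e., squeezing `λ(Mₗ)` in a small
region around one"; PoS §3: "the condition for the variance … to exist … can always be fulfilled by
choosing a large enough `N`"): for Hermitian positive-definite `A`, since `λᵢ^{1/N} → 1`, for all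
sufficiently large `N` every `N`-th-root factor `A^{1/N}` satisfies the variance condition
`2A^{1/N} − I > 0`.
[cite: FinkenrathKnechtliLeder2013OneFlavor, §2.3 (last paragraph)];
[cite: LederFinkenrathKnechtli2014, §3 (paragraph after eq. (3.2))] -/
theorem eventually_posDef_two_nthRoot_sub_one (hA : A.PosDef) :
    ∀ᶠ N : ℕ in Filter.atTop,
      (cfc (fun x : ℝ => x ^ (1 / (N : ℝ))) A + cfc (fun x : ℝ => x ^ (1 / (N : ℝ))) A - 1).PosDef := by
  simp_rw [posDef_two_nthRoot_sub_one_iff hA.1]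
  refine Filter.eventually_all.mpr fun i => ?_
  have hpos : 0 < hA.1.eigenvalues i := hA.eigenvalues_pos i
  have ht : Filter.Tendsto (fun N : ℕ => hA.1.eigenvalues i ^ (1 / (N : ℝ))) Filter.atTop
      (nhds 1) := by
    have h := ((Real.continuousAt_const_rpow hpos.ne').tendsto).comp
      tendsto_one_div_atTop_nhds_zero_nat
    rw [Real.rpow_zero] at h
    exact h
  exact ht.eventually_const_lt (by norm_num)
end Literature.MathematicalPhysics.QuantumFieldTheory.StochasticDeterminant
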